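import Literature.NumberTheory.EllipticCurves.ModularCurveEisensteinCoordinates
import HarnessLib

/-!
# Values and orders of modular functions at the points of `ℍ`, read through `v_τ`

Topic `NumberTheory/EllipticCurves` (the modular function field `K_N = ℂ(X₀(N))` of
`ModularFunctionField.lean`, with the places `P_τ` and valuations `v_τ` of
`ModularFunctionFieldPoints` / `ModularFunctionFieldUniformizers`).  Small shared toolkit for the
"canonical model of `X₀(N)` at CM points" chain: membership in the valuation ring `O_{P_τ}` and in
its maximal ideal in terms of `v_τ` (`mem_pointPlace_iff`, `mem_nonunits_pointPlace_iff`,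
`pointValuation_lt_one_iff`, …), the behaviour of constants, and **values of quotients of modular
forms**: for `x = F/G ∈ K_N` and `c ∈ ℂ`, `x − c = (F − cG)/G` (`mkFn_sub_algebraMap`), so that
`x ∈ O_{P_τ}` with value `c` (`v_τ(x − c) < 1`) as soon as `F − cG` vanishes at `τ` to higher
order than `G` (`pointValuation_mkFn_sub_lt_one_of_orderAt_lt`), `x ∈ O_{P_τ}` iff
`ord_τ G ≤ ord_τ F` (`mkFn_mem_pointPlace_iff`), and in particular `F/Δ` is holomorphic on `ℍ` with
value `F(τ)/Δ(τ)` (`mkFn_deltaN_mem_pointPlace`, `pointValuation_mkFn_deltaN_sub_lt_one`)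
(Diamond–Shurman 2005, §3.2, §7.5; Shimura 1971, §2.4).

Everything is proved; no named facts are introduced.

## References

* F. Diamond, J. Shurman, *A First Course in Modular Forms*, GTM 228, 2005, §3.2, §7.5.
  [DiamondShurman2005]
* G. Shimura, *Introduction to the arithmetic theory of automorphic functions*, 1971, §2.4.
  [ShimuraIATAF1971]
-/

noncomputable section

open scoped MatrixGroups ModularForm Modular Classical IntermediateField WithZero
open CongruenceSubgroup Matrix.SpecialLinearGroup ModularGroup ModularForm EisensteinSeries
open UpperHalfPlane hiding I
open Literature.NumberTheory.DiophantineGeometry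
open Literature.NumberTheory.DiophantineGeometry.AlgFunctionField

namespace Literature.NumberTheory.EllipticCurves.ModularForms

variable {N : ℕ} [NeZero N]

/-! ### `O_{P_τ}` and `m_{P_τ}` through `v_τ` -/

/-- `v_τ(x) < 1 ↔ x = 0 ∨ ν_τ(x) > 0`. [folklore] -/
theorem pointValuation_lt_one_iff (τ : ℍ) (x : modularFunctionField N) :
    pointValuation (N := N) τ x < 1 ↔ x = 0 ∨ 0 < ordAtN τ x := by
  by_cases hx : x = 0
  · simp [hx]
  · rw [pointValuation_apply τ hx, ← WithZero.exp_zero, WithZero.exp_lt_exp]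
    simp [hx]

/-- `v_τ(x) ≤ 1 ↔ x = 0 ∨ ν_τ(x) ≥ 0`. [folklore] -/
theorem pointValuation_le_one_iff (τ : ℍ) (x : modularFunctionField N) :
    pointValuation (N := N) τ x ≤ 1 ↔ x = 0 ∨ 0 ≤ ordAtN τ x := by
  rw [← Valuation.mem_valuationSubring_iff]
  exact mem_valuationSubring_pointValuation_iff τ x

/-- Membership in `O_{P_τ}` through `v_τ`. [folklore] -/
theorem mem_pointPlace_iff (τ : ℍ) (x : modularFunctionField N) :
    x ∈ (pointPlace (N := N) τ).toValuationSubring ↔ pointValuation (N := N) τ x ≤ 1 := by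
  rw [pointPlace_toValuationSubring, Valuation.mem_valuationSubring_iff]

/-- Membership in the maximal ideal `m_{P_τ}` (the non-units of `O_{P_τ}`) through `v_τ`. [folklore] -/
theorem mem_nonunits_pointPlace_iff (τ : ℍ) (x : modularFunctionField N) :
    x ∈ (pointPlace (N := N) τ).toValuationSubring.nonunits ↔ pointValuation (N := N) τ x < 1 := by
  rw [ValuationSubring.mem_nonunits_iff]
  exact ((isEquiv_pointValuation τ).lt_one_iff_lt_one).symm

/-- `v_τ(x) < 1` implies `v_τ(x) ≤ exp(−1)` (the value group is `ℤ`). [folklore] -/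
theorem pointValuation_le_exp_neg_one_of_lt_one {τ : ℍ} {x : modularFunctionField N}
    (h : pointValuation (N := N) τ x < 1) : pointValuation (N := N) τ x ≤ WithZero.exp (-1) := by
  rw [pointValuation_lt_one_iff] at h
  rcases h with h0 | hpos
  · rw [h0, Valuation.map_zero]; exact zero_le
  · have hx : x ≠ 0 := by intro h0; rw [h0, ordAtN_zero] at hpos; exact lt_irrefl _ hpos
    rw [pointValuation_apply τ hx, WithZero.exp_le_exp]; omega

omit [NeZero N] in
/-- `exp(a)ⁿ = exp(n a)` in `ℤᵐ⁰`. [folklore] -/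
theorem exp_pow_eq (a : ℤ) (n : ℕ) : WithZero.exp a ^ n = WithZero.exp (n * a) := by
  induction n with
  | zero => simp
  | succ n ih => rw [pow_succ, ih, ← WithZero.exp_add]; congr 1; push_cast; ring

/-- `v_τ(c) ≤ 1` for a constant. [folklore] -/
theorem pointValuation_algebraMap_le_one (c : ℂ) (τ : ℍ) :
    pointValuation (N := N) τ (algebraMap ℂ (modularFunctionField N) c) ≤ 1 :=
  (mem_pointPlace_iff τ _).mp ((pointPlace (N := N) τ).algebraMap_mem c)

/-- `v_τ(c) = 1` for a nonzero constant. [folklore] -/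
theorem pointValuation_algebraMap_eq_one {c : ℂ} (hc : c ≠ 0) (τ : ℍ) :
    pointValuation (N := N) τ (algebraMap ℂ (modularFunctionField N) c) = 1 := by
  rw [pointValuation_apply τ ((_root_.map_ne_zero _).mpr hc), ordAtN_algebraMap τ hc]; simp

/-- **Uniqueness of the value**: if `v_τ(x − c) < 1` and `v_τ(x − c') < 1` then `c = c'`. [folklore] -/
theorem eq_of_pointValuation_sub_lt_one {τ : ℍ} {x : modularFunctionField N} {c c' : ℂ}
    (hc : pointValuation (N := N) τ (x - algebraMap ℂ (modularFunctionField N) c) < 1)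
    (hc' : pointValuation (N := N) τ (x - algebraMap ℂ (modularFunctionField N) c') < 1) : c = c' := by
  by_contra hne
  have h1 := pointValuation_algebraMap_eq_one (N := N) (sub_ne_zero.mpr (Ne.symm hne)) τ
  have heq : algebraMap ℂ (modularFunctionField N) (c' - c) =
      (x - algebraMap ℂ _ c) - (x - algebraMap ℂ _ c') := by rw [map_sub]; ring
  rw [heq] at h1
  exact absurd h1 ((Valuation.map_sub _ _ _).trans_lt (max_lt hc hc')).ne

/-- If `v_τ(x − c) < 1` then `x ∈ O_{P_τ}`. [folklore] -/
theorem mem_pointPlace_of_pointValuation_sub_lt_one {τ : ℍ} {x : modularFunctionField N} {c : ℂ}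
    (hc : pointValuation (N := N) τ (x - algebraMap ℂ (modularFunctionField N) c) < 1) :
    x ∈ (pointPlace (N := N) τ).toValuationSubring := by
  rw [mem_pointPlace_iff]
  have heq : x = algebraMap ℂ (modularFunctionField N) c + (x - algebraMap ℂ _ c) := by ring
  rw [heq]
  exact (Valuation.map_add _ _ _).trans (max_le (pointValuation_algebraMap_le_one c τ) hc.le)

/-- `O_{P_τ}` as a `ℂ`-subalgebra of `K_N`. [folklore] -/
def pointSubalgebra (τ : ℍ) : Subalgebra ℂ (modularFunctionField N) :=
  { (pointPlace (N := N) τ).toValuationSubring.toSubring with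
    algebraMap_mem' := (pointPlace (N := N) τ).algebraMap_mem }

/-- Membership in `pointSubalgebra`. [folklore] -/
theorem mem_pointSubalgebra_iff (τ : ℍ) (x : modularFunctionField N) :
    x ∈ pointSubalgebra (N := N) τ ↔ x ∈ (pointPlace (N := N) τ).toValuationSubring := Iff.rfl

/-- `j ∈ O_{P_τ}` for every `τ` (`j` is holomorphic on `ℍ`). [folklore] -/
theorem kleinJK_mem_pointPlace (τ : ℍ) :
    (kleinJK N : modularFunctionField N) ∈ (pointPlace (N := N) τ).toValuationSubring := by
  have h : kleinJK N = kleinJSub N τ + algebraMap ℂ (modularFunctionField N) (kleinJ τ) := by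
    rw [kleinJSub_eq]; ring
  rw [h]
  refine add_mem ?_ ((pointPlace (N := N) τ).algebraMap_mem _)
  rw [mem_pointPlace_iff, pointValuation_le_one_iff]
  exact Or.inr (ordAtN_kleinJSub_pos τ).le

/-- `a(j) ∈ O_{P_τ}` for every polynomial `a`. [folklore] -/
theorem aeval_kleinJK_mem_pointPlace (τ : ℍ) (a : Polynomial ℂ) :
    Polynomial.aeval (kleinJK N) a ∈ (pointPlace (N := N) τ).toValuationSubring := by
  have hj : kleinJK N ∈ pointSubalgebra (N := N) τ := kleinJK_mem_pointPlace τ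
  have hle : Algebra.adjoin ℂ {kleinJK N} ≤ pointSubalgebra (N := N) τ :=
    Algebra.adjoin_le (Set.singleton_subset_iff.mpr hj)
  exact hle (Polynomial.aeval_mem_adjoin_singleton ℂ _)

/-! ### Quotients of modular forms: values and orders at a point -/

omit [NeZero N] in
/-- `(F/G − c)·G = F − cG` on `q`-expansions. [folklore] -/
theorem mkFn_sub_algebraMap_mul {k : ℤ} (F G : ModularForm (Gamma0 N) k) (hG : G ≠ 0) (c : ℂ) :
    ((mkFn F G hG - algebraMap ℂ (modularFunctionField N) c : modularFunctionField N) :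
        LaurentSeries ℂ) * qExpansionL N G = qExpansionL N (F - c • G) := by
  rw [sub_eq_add_neg F, qExpansionL_add, qExpansionL_neg, qExpansionL_smul,
    ← HahnSeries.C_mul_eq_smul, ← sub_eq_add_neg, AddSubgroupClass.coe_sub, sub_mul, mkFn_mul,
    ← algebraMap_laurentSeries_apply]
  rfl

omit [NeZero N] in
/-- **`F/G − c = (F − cG)/G` in `K_N`.** [folklore] -/
theorem mkFn_sub_algebraMap {k : ℤ} (F G : ModularForm (Gamma0 N) k) (hG : G ≠ 0) (c : ℂ) :
    mkFn F G hG - algebraMap ℂ (modularFunctionField N) c = mkFn (F - c • G) G hG := by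
  apply Subtype.ext
  have hd : qExpansionL N G ≠ 0 := (qExpansionL_eq_zero_iff N _).not.mpr hG
  rw [show ((mkFn (F - c • G) G hG : modularFunctionField N) : LaurentSeries ℂ) =
      qExpansionL N (F - c • G) / qExpansionL N G from rfl, eq_div_iff hd, mkFn_sub_algebraMap_mul]

omit [NeZero N] in
/-- `mkFn 0 G = 0`. [folklore] -/
theorem mkFn_zero_left {k : ℤ} (G : ModularForm (Gamma0 N) k) (hG : G ≠ 0) :
    mkFn 0 G hG = 0 := by
  apply Subtype.ext; simp [mkFn, qExpansionL_zero]

/-- **Value criterion for a quotient.** If `F − cG = 0`, or `F − cG` vanishes at `τ` to higher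
order than `G`, then `v_τ(F/G − c) < 1`: `F/G ∈ O_{P_τ}` with value `c`. [folklore] -/
theorem pointValuation_mkFn_sub_lt_one_of_orderAt_lt {k : ℤ} {F G : ModularForm (Gamma0 N) k}
    (hG : G ≠ 0) {c : ℂ} (τ : ℍ) (h : F - c • G = 0 ∨ orderAt G τ < orderAt (F - c • G) τ) :
    pointValuation (N := N) τ (mkFn F G hG - algebraMap ℂ (modularFunctionField N) c) < 1 := by
  rw [mkFn_sub_algebraMap, pointValuation_lt_one_iff]
  by_cases h0 : F - c • G = 0
  · left; rw [h0]; exact mkFn_zero_left G hG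
  · right
    have hlt : orderAt G τ < orderAt (F - c • G) τ := h.resolve_left h0
    have hpos : 0 < ordAt τ (mkFn (F - c • G) G hG) := by
      rw [ordAt_mkFn hG h0]; omega
    have h := ordAtN_mul_ellipticPeriod τ (mkFn (F - c • G) G hG)
    rw [← h] at hpos
    exact pos_of_mul_pos_left hpos (ellipticPeriod_cast_pos τ).le

/-- **`F/G ∈ O_{P_τ}` iff `ord_τ G ≤ ord_τ F`** (for `F ≠ 0`). [folklore] -/
theorem mkFn_mem_pointPlace_iff {k : ℤ} {F G : ModularForm (Gamma0 N) k} (hG : G ≠ 0) (hF : F ≠ 0)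
    (τ : ℍ) : mkFn F G hG ∈ (pointPlace (N := N) τ).toValuationSubring ↔ orderAt G τ ≤ orderAt F τ := by
  rw [mem_pointPlace_iff, pointValuation_le_one_iff]
  have hx : mkFn F G hG ≠ 0 := mkFn_ne_zero hG hF
  have h := ordAtN_mul_ellipticPeriod τ (mkFn F G hG)
  rw [ordAt_mkFn hG hF] at h
  have he := ellipticPeriod_cast_pos (N := N) τ
  constructor
  · rintro (h0 | h0)
    · exact absurd h0 hx
    · have : (0 : ℤ) ≤ (orderAt F τ : ℤ) - orderAt G τ := by rw [← h]; positivity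
      omega
  · intro hle
    right
    have : (0 : ℤ) ≤ ordAtN τ (mkFn F G hG) * ellipticPeriod (Gamma0 N) τ := by rw [h]; omega
    exact nonneg_of_mul_nonneg_left this he

/-- **Pole criterion**: if `ord_τ F < ord_τ G` then `(F/G)⁻¹ ∈ m_{P_τ}` (so `F/G ∉ O_{P_τ}`). [folklore] -/
theorem pointValuation_mkFn_inv_lt_one {k : ℤ} {F G : ModularForm (Gamma0 N) k} (hG : G ≠ 0)
    (hF : F ≠ 0) {τ : ℍ} (h : orderAt F τ < orderAt G τ) :
    pointValuation (N := N) τ (mkFn F G hG)⁻¹ < 1 := by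
  have hx : mkFn F G hG ≠ 0 := mkFn_ne_zero hG hF
  rw [pointValuation_lt_one_iff]
  right
  have hinv : ordAtN τ (mkFn F G hG)⁻¹ + ordAtN τ (mkFn F G hG) = 0 := by
    rw [← ordAtN_mul τ (inv_ne_zero hx) hx, inv_mul_cancel₀ hx,
      show (1 : modularFunctionField N) = algebraMap ℂ (modularFunctionField N) 1 from (map_one _).symm,
      ordAtN_algebraMap τ one_ne_zero]
  have hneg : ordAtN τ (mkFn F G hG) < 0 := by
    have h' := ordAtN_mul_ellipticPeriod τ (mkFn F G hG)
    rw [ordAt_mkFn hG hF] at h'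
    have he := ellipticPeriod_cast_pos (N := N) τ
    by_contra hnn
    rw [not_lt] at hnn
    have : (0 : ℤ) ≤ (orderAt F τ : ℤ) - orderAt G τ := by rw [← h']; positivity
    omega
  omega

/-! ### Quotients `F/Δ` of weight-`12` forms: holomorphic, with value `F(τ)/Δ(τ)` -/

omit [NeZero N] in
/-- `ord_τ(F/Δ) = ord_τ(F)`. [folklore] -/
theorem ordAt_mkFn_deltaN {F : ModularForm (Gamma0 N) 12} (hF : F ≠ 0) (τ : ℍ) :
    ordAt τ (mkFn F (deltaN N) ofLevelOne_delta_ne_zero) = orderAt F τ := by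
  rw [ordAt_mkFn ofLevelOne_delta_ne_zero hF, orderAt_delta]; simp

/-- `F/Δ ∈ O_{P_τ}` for every `τ`. [folklore] -/
theorem mkFn_deltaN_mem_pointPlace (F : ModularForm (Gamma0 N) 12) (τ : ℍ) :
    mkFn F (deltaN N) ofLevelOne_delta_ne_zero ∈ (pointPlace (N := N) τ).toValuationSubring := by
  by_cases hF : F = 0
  · subst hF; rw [mkFn_zero_left]; exact zero_mem _
  · rw [mkFn_mem_pointPlace_iff ofLevelOne_delta_ne_zero hF, orderAt_delta]; exact Nat.zero_le _

omit [NeZero N] in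
/-- `(F − cΔ)(τ) = F(τ) − cΔ(τ)`. [folklore] -/
theorem sub_smul_deltaN_apply (F : ModularForm (Gamma0 N) 12) (c : ℂ) (τ : ℍ) :
    (F - c • deltaN N) τ = F τ - c * ModularForm.discriminant τ := by
  simp [deltaN, coe_ofLevelOne, delta, sub_eq_add_neg]

/-- **The value of `F/Δ` at `P_τ` is `F(τ)/Δ(τ)`**: `v_τ(F/Δ − F(τ)/Δ(τ)) < 1`. [folklore] -/
theorem pointValuation_mkFn_deltaN_sub_lt_one (F : ModularForm (Gamma0 N) 12) (τ : ℍ) :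
    pointValuation (N := N) τ (mkFn F (deltaN N) ofLevelOne_delta_ne_zero -
      algebraMap ℂ (modularFunctionField N) (F τ / ModularForm.discriminant τ)) < 1 := by
  apply pointValuation_mkFn_sub_lt_one_of_orderAt_lt
  set G : ModularForm (Gamma0 N) 12 := F - (F τ / ModularForm.discriminant τ) • deltaN N with hG
  by_cases hG0 : G = 0
  · exact Or.inl hG0
  · right
    have hGτ : G τ = 0 := by
      rw [hG, sub_smul_deltaN_apply, div_mul_cancel₀ _ (ModularForm.discriminant_ne_zero τ), sub_self]
    rw [orderAt_delta]
    exact Nat.pos_of_ne_zero fun h0 ↦ (orderAt_eq_zero_iff hG0 τ).mp h0 hGτ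

/-- A nonzero `F/Δ` has `v_τ`-value `1` exactly when `F(τ) ≠ 0`. [folklore] -/
theorem pointValuation_mkFn_deltaN_eq_one_iff {F : ModularForm (Gamma0 N) 12} (hF : F ≠ 0) (τ : ℍ) :
    pointValuation (N := N) τ (mkFn F (deltaN N) ofLevelOne_delta_ne_zero) = 1 ↔ F τ ≠ 0 := by
  have hx : mkFn F (deltaN N) ofLevelOne_delta_ne_zero ≠ 0 := mkFn_ne_zero _ hF
  rw [pointValuation_apply τ hx, ← WithZero.exp_zero, WithZero.exp_inj, neg_eq_zero,
    ← orderAt_eq_zero_iff hF τ]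
  have h := ordAtN_mul_ellipticPeriod τ (mkFn F (deltaN N) ofLevelOne_delta_ne_zero)
  rw [ordAt_mkFn_deltaN hF] at h
  have he := ellipticPeriod_cast_pos (N := N) τ
  constructor
  · intro h0; rw [h0, zero_mul] at h; exact_mod_cast h.symm
  · intro h0
    rw [h0, Nat.cast_zero] at h
    rcases mul_eq_zero.mp h with h1 | h1
    · exact h1
    · exact absurd h1 he.ne'

end Literature.NumberTheory.EllipticCurves.ModularForms

end
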